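import Summits.Ventures.PercRepro.SevenThreeLineBound

/-!
# PercRepro — the `(7,3)` cell: the partition of the brackets by dual rank (p3, gen 16)

The bookkeeping identity `supply T W − 28/5 = Σ_{∅ ≠ X ⊆ W} bracket X` (`SevenThreeBookkeeping.lean`) is split by the
dual rank `d = drk E (W ∖ X) ∈ {0, 1, 2, 3}` of the removed set (`sum_bracket_eq_four_parts`):
* `d = 3`: `T ∪ X` is independent and the bracket vanishes (`bracket_eq_zero_of_drk_three`);
* `d = 0`: `W ∖ X ⊆ L₀`, so `|X| ≥ 4` and the bracket is `≥ 0` (`bracket_nonneg_of_drk_zero`);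
* `d = 1`: the STAR FIBRES, one per series class `N` of the world (`sum_drk_one_eq_sum_star`);
* `d = 2`: the LINE FIBRES, one per line `λ = dcl Z` of the dual (`sum_drk_two_eq_sum_line`).
(`P3-C025-seven-three-plan.md` §9 (R3): `supply − Φ = Σ_λ Δ_λ + Σ_P Δ_P + Γ`, `Γ ≥ 0`.)
-/

namespace PercRepro

namespace SevenThree

open Finset ThmH SixThree

variable {α : Type*} [DecidableEq α] {M : Matroid α} [M.Finite]

/-- `drk E Z ≤ 3` for `Z ⊆ W`. -/
theorem drk_le_three {T W Z : Finset α} (h : ReducedWorld M T W) (hr : M.eRank = 7) (hZ : Z ⊆ W) :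
    drk M (T ∪ W) Z ≤ 3 := by
  have h1 := nrk_witness_add_three h hr (X := W \ Z) Finset.sdiff_subset
  rw [Finset.sdiff_sdiff_eq_self hZ] at h1
  have := nrk_le_card (M := M) (T ∪ (W \ Z))
  omega

/-- `drk E W = 3`: removing all of `W` leaves `T`, of nullity `0`. -/
theorem drk_W_eq_three {T W : Finset α} (h : ReducedWorld M T W) (hr : M.eRank = 7) : drk M (T ∪ W) W = 3 := by
  have h1 := nrk_witness_add_three h hr (X := ∅) (Finset.empty_subset W)
  rw [Finset.sdiff_empty, Finset.union_empty, nrk_subset_T h (Finset.Subset.refl T), h.T_card] at h1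
  omega

/-- **`d = 3`**: `T ∪ X` is independent, so the bracket vanishes (`X ≠ ∅`). -/
theorem bracket_eq_zero_of_drk_three {T W X : Finset α} (h : ReducedWorld M T W) (hr : M.eRank = 7) (hX : X ⊆ W)
    (hne : X ≠ ∅) (hd : drk M (T ∪ W) (W \ X) = 3) : bracket M T X = 0 := by
  have h1 := nrk_witness_add_three h hr hX
  rw [hd] at h1
  have hind : M.Indep ((T ∪ X : Finset α) : Set α) := by
    rw [Matroid.indep_iff_eRk_eq_encard_of_finite (Finset.finite_toSet _), ← coe_nrk,
      Set.encard_coe_eq_coe_finsetCard]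
    congr 1
    omega
  exact bracket_eq_zero_of_indep h hX hne hind

/-- **`d = 0`**: `W ∖ X ⊆ L₀`, so `|X| ≥ 4` and the bracket is `≥ 0`. -/
theorem bracket_nonneg_of_drk_zero {T W X : Finset α} (h : ReducedWorld M T W) (hr : M.eRank = 7) (hX : X ⊆ W)
    (hd : drk M (T ∪ W) (W \ X) = 0) : 0 ≤ bracket M T X := by
  apply bracket_nonneg_of_four_le
  -- `(W ∖ X) ∖ L₀ = ∅`: a nonempty subset of the cyclic part has positive dual rank
  have hsub : (W \ X) \ coloopsOf M (T ∪ W) ⊆ cyclicPart M (T ∪ W) := by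
    intro e he
    rw [Finset.mem_sdiff] at he
    exact Finset.mem_sdiff.2 ⟨Finset.mem_union_right T (Finset.mem_sdiff.1 he.1).1, he.2⟩
  have hempty : (W \ X) \ coloopsOf M (T ∪ W) = ∅ := by
    by_contra hne
    have := one_le_drk_of_nonempty (world_subset h) hsub (Finset.nonempty_iff_ne_empty.2 hne)
    rw [← drk_eq_drk_sdiff_coloops h, hd] at this
    omega
  have hZL : W \ X ⊆ coloopsOf M (T ∪ W) := Finset.sdiff_eq_empty_iff_subset.1 hempty
  have h1 := Finset.card_le_card hZL
  have h2 := card_coloopsOf_world_le h hr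
  have h3 : (W \ X).card + X.card = 7 := by
    rw [Finset.card_sdiff_of_subset hX, h.W_card]
    have := Finset.card_le_card hX
    rw [h.W_card] at this
    omega
  omega

/-- The star fibre of a class `N`, in `X`-form. -/
noncomputable def starFibre (M : Matroid α) [M.Finite] (T W N : Finset α) : Finset (Finset α) :=
  W.powerset.filter (fun X => (W \ X) \ coloopsOf M (T ∪ W) ⊆ N ∧ ((W \ X) \ coloopsOf M (T ∪ W)).Nonempty)

/-- The lines of the dual met by `W`: the closures of the `Z ⊆ W` of dual rank `2`. -/
noncomputable def lines (M : Matroid α) [M.Finite] (T W : Finset α) : Finset (Finset α) :=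
  (W.powerset.filter (fun Z => drk M (T ∪ W) Z = 2)).image (dcl M T W)

/-- A line is a subset of `E` of dual rank `2`, equal to its closure. -/
theorem line_props {T W lam : Finset α} (hlam : lam ∈ lines M T W) :
    lam ⊆ T ∪ W ∧ drk M (T ∪ W) lam = 2 ∧ dcl M T W lam = lam := by
  unfold lines at hlam
  rw [Finset.mem_image] at hlam
  obtain ⟨Z, hZ, rfl⟩ := hlam
  rw [Finset.mem_filter, Finset.mem_powerset] at hZ
  have hZE : Z ⊆ T ∪ W := hZ.1.trans Finset.subset_union_right
  exact ⟨dcl_subset T W Z, by rw [drk_dcl hZE, hZ.2], dcl_dcl hZE⟩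

/-- **`d = 1` is the sum of the star fibres**. -/
theorem sum_drk_one_eq_sum_star {T W : Finset α} (h : ReducedWorld M T W) (hr : M.eRank = 7) :
    ∑ X ∈ W.powerset.filter (fun X => X ≠ ∅ ∧ drk M (T ∪ W) (W \ X) = 1), bracket M T X =
      ∑ N ∈ serClasses M (T ∪ W), ∑ X ∈ starFibre M T W N, bracket M T X := by
  have hE := world_subset h
  have hsplit : W.powerset.filter (fun X => X ≠ ∅ ∧ drk M (T ∪ W) (W \ X) = 1) =
      (serClasses M (T ∪ W)).biUnion (fun N => starFibre M T W N) := by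
    ext X
    rw [Finset.mem_filter, Finset.mem_powerset, Finset.mem_biUnion]
    constructor
    · rintro ⟨hX, -, hd⟩
      obtain ⟨hne, N, hN, hsub⟩ := (drk_eq_one_iff_subset_serClass h (Finset.sdiff_subset.trans
        Finset.subset_union_right)).1 hd
      exact ⟨N, hN, by unfold starFibre; rw [Finset.mem_filter, Finset.mem_powerset]; exact ⟨hX, hsub, hne⟩⟩
    · rintro ⟨N, hN, hX⟩
      unfold starFibre at hX
      rw [Finset.mem_filter, Finset.mem_powerset] at hX
      have hd : drk M (T ∪ W) (W \ X) = 1 :=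
        (drk_eq_one_iff_subset_serClass h (Finset.sdiff_subset.trans Finset.subset_union_right)).2
          ⟨hX.2.2, N, hN, hX.2.1⟩
      refine ⟨hX.1, ?_, hd⟩
      rintro rfl
      rw [Finset.sdiff_empty, drk_W_eq_three h hr] at hd
      omega
  rw [hsplit, Finset.sum_biUnion]
  intro N hN N' hN' hne
  rw [Finset.mem_coe] at hN hN'
  rw [Function.onFun, Finset.disjoint_left]
  intro X hX hX'
  unfold starFibre at hX hX'
  rw [Finset.mem_filter] at hX hX'
  obtain ⟨e, he⟩ := hX.2.2
  have hdisj := pairwiseDisjoint_serClasses hE hN hN' hne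
  rw [Function.onFun, id, id] at hdisj
  exact Finset.disjoint_left.1 hdisj (hX.2.1 he) (hX'.2.1 he)

/-- **`d = 2` is the sum of the line fibres**. -/
theorem sum_drk_two_eq_sum_line {T W : Finset α} (h : ReducedWorld M T W) (hr : M.eRank = 7) :
    ∑ X ∈ W.powerset.filter (fun X => X ≠ ∅ ∧ drk M (T ∪ W) (W \ X) = 2), bracket M T X =
      ∑ lam ∈ lines M T W, ∑ Z ∈ (lam ∩ W).powerset.filter (fun Z => drk M (T ∪ W) Z = 2), bracket M T (W \ Z) := by
  -- reindex by `Z = W ∖ X`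
  have hre : ∑ X ∈ W.powerset.filter (fun X => X ≠ ∅ ∧ drk M (T ∪ W) (W \ X) = 2), bracket M T X =
      ∑ Z ∈ W.powerset.filter (fun Z => drk M (T ∪ W) Z = 2), bracket M T (W \ Z) := by
    apply Finset.sum_nbij' (fun X => W \ X) (fun Z => W \ Z)
    · intro X hX
      rw [Finset.mem_filter, Finset.mem_powerset] at hX ⊢
      exact ⟨Finset.sdiff_subset, hX.2.2⟩
    · intro Z hZ
      rw [Finset.mem_filter, Finset.mem_powerset] at hZ ⊢
      refine ⟨Finset.sdiff_subset, ?_, by rw [Finset.sdiff_sdiff_eq_self hZ.1]; exact hZ.2⟩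
      intro hh
      rw [Finset.sdiff_eq_empty_iff_subset] at hh
      have hZW : Z = W := Finset.Subset.antisymm hZ.1 hh
      rw [hZW, drk_W_eq_three h hr] at hZ
      omega
    · intro X hX
      rw [Finset.mem_filter, Finset.mem_powerset] at hX
      exact Finset.sdiff_sdiff_eq_self hX.1
    · intro Z hZ
      rw [Finset.mem_filter, Finset.mem_powerset] at hZ
      exact Finset.sdiff_sdiff_eq_self hZ.1
    · intro X hX
      rw [Finset.mem_filter, Finset.mem_powerset] at hX
      rw [Finset.sdiff_sdiff_eq_self hX.1]
  rw [hre]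
  -- group by the closure
  rw [← Finset.sum_fiberwise_of_maps_to (g := dcl M T W) (t := lines M T W)]
  · apply Finset.sum_congr rfl
    intro lam hlam
    obtain ⟨hlamE, hlam2, hlamcl⟩ := line_props hlam
    congr 1
    ext Z
    rw [Finset.mem_filter, Finset.mem_filter, Finset.mem_powerset, Finset.mem_filter, Finset.mem_powerset]
    constructor
    · rintro ⟨⟨hZW, hd⟩, hdcl⟩
      refine ⟨Finset.subset_inter ?_ hZW, hd⟩
      rw [← hdcl]
      exact subset_dcl (hZW.trans Finset.subset_union_right)
    · rintro ⟨hZ, hd⟩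
      refine ⟨⟨hZ.trans Finset.inter_subset_right, hd⟩, ?_⟩
      rw [dcl_eq_of_subset hlamE (by rw [hlamcl]; exact hZ.trans Finset.inter_subset_left) (by rw [hd, hlam2]),
        hlamcl]
  · intro Z hZ
    unfold lines
    rw [Finset.mem_image]
    exact ⟨Z, hZ, rfl⟩

open scoped Classical in
/-- **The four parts**: `Σ_{∅ ≠ X ⊆ W} bracket X = (d = 0) + Σ_N star + Σ_λ line + (d = 3)`. -/
theorem sum_bracket_eq_four_parts {T W : Finset α} (h : ReducedWorld M T W) (hr : M.eRank = 7) :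
    ∑ X ∈ W.powerset.filter (fun X => X ≠ ∅), bracket M T X =
      ∑ X ∈ W.powerset.filter (fun X => X ≠ ∅ ∧ drk M (T ∪ W) (W \ X) = 0), bracket M T X +
      ∑ N ∈ serClasses M (T ∪ W), ∑ X ∈ starFibre M T W N, bracket M T X +
      ∑ lam ∈ lines M T W, ∑ Z ∈ (lam ∩ W).powerset.filter (fun Z => drk M (T ∪ W) Z = 2), bracket M T (W \ Z) +
      ∑ X ∈ W.powerset.filter (fun X => X ≠ ∅ ∧ drk M (T ∪ W) (W \ X) = 3), bracket M T X := by
  rw [← sum_drk_one_eq_sum_star h hr, ← sum_drk_two_eq_sum_line h hr]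
  rw [← Finset.sum_fiberwise_of_maps_to (g := fun X => drk M (T ∪ W) (W \ X)) (t := Finset.range 4)]
  · simp only [Finset.sum_range_succ, Finset.sum_range_zero, zero_add, Finset.filter_filter]
  · intro X hX
    rw [Finset.mem_filter, Finset.mem_powerset] at hX
    rw [Finset.mem_range]
    have := drk_le_three h hr (Z := W \ X) Finset.sdiff_subset
    omega

end SevenThree

end PercRepro
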